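import Mathlib
import Summits.Ventures.HodgeRepro2.T5CharactersTrivialOnBase
import Summits.Ventures.HodgeRepro2.T5AdicCompletionRelativeDuality
import Summits.Ventures.HodgeRepro2.T5LocalNormIndex
import Summits.Ventures.HodgeRepro2.T6N5TateTwist
import Summits.Ventures.HodgeRepro2.T6N5Hyp
import Summits.Ventures.HodgeRepro2.T6N5LocalDatum
import Summits.Ventures.HodgeRepro2.T6N5LocalHyp
import Summits.Ventures.HodgeRepro2.T6N5Local
import Summits.Ventures.HodgeRepro2.T6N5LocalCharDatum
import Summits.Ventures.HodgeRepro2.T6N5LocalRamHyp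
import Summits.Ventures.HodgeRepro2.T6N5LocalRam
import Summits.Ventures.HodgeRepro2.T6N5LocalInertCompletion
import Summits.Ventures.HodgeRepro2.T6N5LocalRamCompletion
import Summits.Ventures.HodgeRepro2.T6N5LocalRamOnCompletion
import Summits.Ventures.HodgeRepro2.T6N5LocalRamOnCompletionAll
import Summits.Ventures.HodgeRepro2.T6N5LocalTateChars

/-!
# T6N5LocalRamTateSide — Tier 6, M2 sub-step N5 (t6-p8's half): LAYER III FOR THE TATE SIDE at a ramified place

The ramified assembly `T6N5LocalRamOnCompletionAll.N5Local_main_ram_completion_all'` (every finite ramified place,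
tame or wild) takes the Tate side as a bundle of parameters `T : TateSideRam L_wˣ` with the two Tate-side
CONDITIONS `hω : |·|^{1/2} unramified` and `hconj : ψ_δ^σ = ψ_δ^{−1}`. With the additive characters, the absolute
value, `ω_s`, the Haar measures and the self-dual measures modelled in `T6N5LocalTateChars`, this file models the
remaining ramified Tate-side fields and proves both conditions:
* `n(ψ)` := the exact conductor `cond` (Tate's `n(ψ)` in (3.2.6.3));
* `ψ^σ = ψ^{−1}` := `∀ y, ψ(σ y) = ψ(y)⁻¹` (`IsConjInvC`);
* `hω`: `ω_{1/2} = ‖·‖^{1/2}` is trivial on `O_{L_w}^×` (`omega_half_unramified`: `‖u‖ = 1` for a unit);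
* `hconj`: a continuous character of `L_w` trivial on `K_v` satisfies `ψ(σ y) = ψ(y)⁻¹`
  (`isConjInvC_of_trivial_on_base`: `ψ = ψ_F ∘ coord` for the basis `(1, θ)` with `σ θ = −θ` of p4's
  `exists_basis_forall_existsUnique`, and `coord(σ y) = −coord(y)`) — the datum's `ψ_δ = ψ_F ∘ tr(δ ·)` is such.
What stays parametric: `epsT` with its displays `hT6` (Tate (3.2.6.3)), `hG` (GGP Prop. 5.1 (2)), `h35` (BFGYYZ Thm
3.5), and the Weil-side data with the (A1) / Weil inputs (`TateParams`). `N5Local_main_ram_completion_tate` is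
Theorem N5.T2 at every finite ramified place with the Tate side so modelled.
README §8(d): uses an L-value-free non-vanishing device: NO.
-/

namespace Summit.Ventures.HodgeRepro2.T6.N5LocalRamTateSide

open Summit.Ventures.HodgeRepro2 IsDedekindDomain HeightOneSpectrum
  Summit.Ventures.HodgeRepro2.T6.N5LocalDatum Summit.Ventures.HodgeRepro2.T6.N5LocalCharDatum
  Summit.Ventures.HodgeRepro2.T6.N5LocalRamDatum Summit.Ventures.HodgeRepro2.T6.N5Local
  Summit.Ventures.HodgeRepro2.T6.Hyp Summit.Ventures.HodgeRepro2.T6.N5LocalInertCompletion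
  Summit.Ventures.HodgeRepro2.T6.N5LocalRamCompletion Summit.Ventures.HodgeRepro2.T6.N5LocalRamOnCompletion
  Summit.Ventures.HodgeRepro2.T6.N5LocalRamOnCompletionAll Summit.Ventures.HodgeRepro2.T6.N5LocalTateChars

-- `K`, `L` in `Type` (universe `0`): `CharDatum.E : Type`, `TateSideRam.Psi : Type`.
variable {K : Type} [Field K] [NumberField K] (v : HeightOneSpectrum (NumberField.RingOfIntegers K))
  {L : Type} [Field L] [NumberField L] [Algebra K L] (w : HeightOneSpectrum (NumberField.RingOfIntegers L))
  [w.asIdeal.LiesOver v.asIdeal]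
  [ContinuousSMul (v.adicCompletion K) (w.adicCompletion L)]
  [IsScalarTower K (v.adicCompletion K) (w.adicCompletion L)]

noncomputable section

/-- `ψ^σ = ψ^{−1}`: `ψ(σ y) = ψ(y)⁻¹` for all `y`. -/
def IsConjInvC (σ : Gal(w.adicCompletion L/v.adicCompletion K)) (ψ : PsiC w) : Prop :=
  ∀ y, ψ.1 (σ y) = (ψ.1 y)⁻¹

omit [ContinuousSMul (v.adicCompletion K) (w.adicCompletion L)]
  [IsScalarTower K (v.adicCompletion K) (w.adicCompletion L)] in
/-- For a basis `(1, θ)` with `σ θ = −θ`, the `θ`-coordinate changes sign under `σ`. -/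
theorem coordHom_apply_sigma (σ : Gal(w.adicCompletion L/v.adicCompletion K))
    (b : Module.Basis (Fin 2) (v.adicCompletion K) (w.adicCompletion L)) (hb0 : b 0 = 1)
    (hb1 : σ (b 1) = -b 1) (y : w.adicCompletion L) :
    T5CharactersTrivialOnBase.coordHom b (σ y) = -T5CharactersTrivialOnBase.coordHom b y := by
  have hy := T5CharactersTrivialOnBase.eq_algebraMap_add_smul b hb0 y
  have h1 : T5CharactersTrivialOnBase.coordHom b (σ y) = -(b.repr y) 1 := by
    conv_lhs => rw [hy]
    rw [map_add, AlgEquiv.commutes, Algebra.smul_def, map_mul, AlgEquiv.commutes, hb1, mul_neg,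
      ← Algebra.smul_def, map_add, map_neg, T5CharactersTrivialOnBase.coordHom_algebraMap b hb0,
      T5CharactersTrivialOnBase.coordHom_smul, zero_add]
  have h2 : T5CharactersTrivialOnBase.coordHom b y = (b.repr y) 1 := by
    conv_lhs => rw [hy]
    rw [map_add, T5CharactersTrivialOnBase.coordHom_algebraMap b hb0, T5CharactersTrivialOnBase.coordHom_smul,
      zero_add]
  rw [h1, h2]

omit [ContinuousSMul (v.adicCompletion K) (w.adicCompletion L)]
  [IsScalarTower K (v.adicCompletion K) (w.adicCompletion L)] in
/-- `hconj`: a continuous non-trivial character of `L_w` trivial on `K_v` satisfies `ψ(σ y) = ψ(y)⁻¹`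
(the datum's `ψ_δ = ψ_F ∘ tr(δ ·)`, `σ δ = −δ`). -/
theorem isConjInvC_of_trivial_on_base (h2 : Module.finrank (v.adicCompletion K) (w.adicCompletion L) = 2)
    (σ : Gal(w.adicCompletion L/v.adicCompletion K)) (hσ : σ ≠ 1) (ψ : PsiC w)
    (hK : ∀ a : v.adicCompletion K, ψ.1 (algebraMap (v.adicCompletion K) (w.adicCompletion L) a) = 1) :
    IsConjInvC v w σ ψ := by
  intro y
  obtain ⟨b, hb0, hb1, -⟩ :=
    T5AdicCompletionRelativeDuality.exists_basis_forall_existsUnique v w h2 σ hσ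
  have hψ : ψ.1 = T5CharactersTrivialOnBase.ofBase b (T5CharactersTrivialOnBase.toBase b ψ.1) :=
    (T5CharactersTrivialOnBase.ofBase_toBase b hb0 ψ.1 hK).symm
  rw [hψ, T5CharactersTrivialOnBase.ofBase_apply, T5CharactersTrivialOnBase.ofBase_apply,
    coordHom_apply_sigma v w σ b hb0 hb1, AddChar.map_neg_eq_inv]

omit [Algebra K L] [w.asIdeal.LiesOver v.asIdeal] [ContinuousSMul (v.adicCompletion K) (w.adicCompletion L)]
  [IsScalarTower K (v.adicCompletion K) (w.adicCompletion L)] in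
/-- `hω`: `ω_{1/2} = ‖·‖^{1/2}` is unramified — trivial on `Uπ 0 = O_{L_w}^×` (`‖u‖ = q_E^0 = 1`). -/
theorem omega_half_unramified (π : w.adicCompletionIntegers L) :
    Uπ w π 0 ≤ (omega w (1 / 2)).ker := by
  rintro x ⟨u, -, rfl⟩
  rw [MonoidHom.mem_ker]
  apply Units.ext
  rw [omega_apply, Units.val_one]
  have h1 : nrm w (intUnits w u) = 1 := by
    rw [nrm_eq]
    show (qE w : ℝ) ^ (Valued.v ((u : w.adicCompletionIntegers L) : w.adicCompletion L)).log = 1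
    rw [T5AdicCompletionNormSurjective.val_coe_units_eq_one w u, WithZero.log_one, zpow_zero]
  rw [h1, Complex.ofReal_one, Complex.one_cpow]

/-- The Tate side of the ramified datum on Mathlib's completions: every field modelled except the ε-factor and
the Weil-side parameters `P`, for the datum's `ψ_δ`. -/
def mkTateSideRam (σ : Gal(w.adicCompletion L/v.adicCompletion K))
    (P : TateParams (w.adicCompletion L)ˣ (PsiC w) ℝ) (ψδ : PsiC w) : TateSideRam (w.adicCompletion L)ˣ where
  Psi := PsiC w
  Meas := ℝ
  omega := omega w
  nrm := nrm w
  tw := twist w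
  sc := fun r m => r * m
  sd := sd w
  epsT := P.epsT
  ψδ := ψδ
  χW := P.χW
  epsdW := P.epsdW
  Theta := P.Theta
  ηLine := P.ηLine
  ηu := P.ηu
  n := cond w
  IsConjInv := IsConjInvC v w σ

/-- THEOREM N5.T2 AT EVERY FINITE RAMIFIED PLACE (tame or wild) WITH THE TATE SIDE MODELLED:
`N5Local_main_ram_completion_all'` on `mkTateSideRam`, with `hω` and `hconj` discharged. Hypotheses: the ramified
place data, the datum's `ψ_δ` (continuous, non-trivial, trivial on `K_v`), the parameters `P` with the displays
`hT6` (Tate (3.2.6.3)), `hG` (GGP Prop. 5.1 (2)), `h35` (BFGYYZ Thm 3.5), and the (A1) / Weil-side inputs. -/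
theorem N5Local_main_ram_completion_tate
    (h2 : Module.finrank (v.adicCompletion K) (w.adicCompletion L) = 2)
    {ϖ : v.adicCompletionIntegers K} (hϖ : Irreducible ϖ) {π : w.adicCompletionIntegers L} (hπ : Irreducible π)
    (hram : ¬ Irreducible (algebraMap (v.adicCompletionIntegers K) (w.adicCompletionIntegers L) ϖ))
    (σ : Gal(w.adicCompletion L/v.adicCompletion K)) (hσ : σ ≠ 1)
    (P : TateParams (w.adicCompletion L)ˣ (PsiC w) ℝ) (ψδ : PsiC w)
    (hK : ∀ a : v.adicCompletion K, ψδ.1 (algebraMap (v.adicCompletion K) (w.adicCompletion L) a) = 1)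
    (hT6 : Tate1979_3_2_6_3 (mkRam v w hπ σ (T5LocalNormIndex.index_normGroup_eq_two v w σ h2 hσ)
      (mkTateSideRam v w σ P ψδ)))
    (hG : GGP2012_Prop5_1_2 (mkRam v w hπ σ (T5LocalNormIndex.index_normGroup_eq_two v w σ h2 hσ)
      (mkTateSideRam v w σ P ψδ)))
    (h35 : BFGYYZ2025_Thm3_5 (mkRam v w hπ σ (T5LocalNormIndex.index_normGroup_eq_two v w σ h2 hσ)
      (mkTateSideRam v w σ P ψδ)).toLocalSignDatum)
    (hA1 : ∀ s : ℤˣ, ∃ α : (w.adicCompletion L)ˣ →* ℂˣ,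
      (mkRam v w hπ σ (T5LocalNormIndex.index_normGroup_eq_two v w σ h2 hσ)
        (mkTateSideRam v w σ P ψδ)).toLocalSignDatum.IsCO α ∧ P.Theta s α)
    (hW : P.epsdW = 1)
    (hχW : (mkRam v w hπ σ (T5LocalNormIndex.index_normGroup_eq_two v w σ h2 hσ)
      (mkTateSideRam v w σ P ψδ)).toLocalSignDatum.IsCS P.χW) :
    ∃ ξ : Fin 4 → (w.adicCompletion L)ˣ →* ℂˣ,
      LocalSolution (mkRam v w hπ σ (T5LocalNormIndex.index_normGroup_eq_two v w σ h2 hσ)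
        (mkTateSideRam v w σ P ψδ)).toLocalSignDatum ξ :=
  N5Local_main_ram_completion_all' v w h2 hϖ hπ hram σ hσ (mkTateSideRam v w σ P ψδ) hT6 hG
    (omega_half_unramified w π) (isConjInvC_of_trivial_on_base v w h2 σ hσ ψδ hK) h35 hA1 hW hχW

end

end Summit.Ventures.HodgeRepro2.T6.N5LocalRamTateSide
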